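import Literature.Analysis.Fourier.MultiplierOpL2
import Literature.Barriers.AtomisticToContinuum.NoBVEstimatesMultiDSymbolBound
import Literature.Barriers.AtomisticToContinuum.NoBVEstimatesMultiDFourierRepresentation
import HarnessLib

/-!
# Rauch's reduction `Rauch1986_L1GradientEstimate_imp_LpMultiplier` relative to its
harmonic-analysis inputs and finite speed of propagation

`NoBVEstimatesMultiDLinearStep.lean` vendors as the named fact
`Rauch1986_L1GradientEstimate_imp_LpMultiplier` the first ingredient of Rauch's linear step
[Rauch1986, Proof of Theorem p. 483, (5)–(6)] (since the split review of 2026-08-15: without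
zeroth-order term, `B₁ = 0`): for a constant-coefficient system `A₀∂ₜv + Σ Aⱼ∂ⱼv = 0` in
Rauch's class at `0`, if every `φ ∈ C₀^∞(ℝᵈ; ℝᵏ)` is the datum of a classical solution `v` on
`[0, T]` with `v(T)` compactly supported and `∫‖∇ₓv(T)‖ ≤ c∫‖∇ₓφ‖` (Rauch's (5)), then Rauch's
multiplier `M = rauchSymbol A₀ A 0 T` is in `M_p` for every `1 < p ≤ 2`. (The lemmas of this file
are proved for a general zeroth-order term `B₁`; only the final application specialises.)

This file PROVES the fact relative to three named facts already in the tree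
(`Rauch1986_L1GradientEstimate_imp_LpMultiplier_of`):

1. `Literature.Analysis.Fourier.gradientLpBound_interpolation` — "Interpolating, (5) is valid
   for `Lᵖ`, `1 < p < 2`" (`SobolevMultiplierBound.lean`);
2. `Literature.Analysis.Fourier.isLpMultiplier_of_gradientLpBound` — Rauch's (6) and the Riesz
   transforms (`SobolevMultiplierBound.lean`);
3. `Rauch1986_finitePropagationSpeed` — finite speed of propagation for Rauch's class
   (`NoBVEstimatesMultiDSmallAmplitude.lean`; its symmetrizable branch is discharged,
   `Rauch1986_finitePropagationSpeed_symmetrizable_holds`, and so are `k ≤ 2` and `d ≤ 1`: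
   only the strictly hyperbolic branch with `d ≥ 2`, `k ≥ 3` is open,
   `Rauch1986_finitePropagationSpeed_of_three_le`), needed — for the constant-coefficient
   system only — to know that the solutions `v` of the hypothesis stay compactly supported
   on `[0, T]`.

The proved part is everything else in Rauch's paragraph: by finite speed of propagation and
the Fourier representation (`fourier_cplx_slice_eq_of_hasPropagationSpeed`,
`NoBVEstimatesMultiDFourierRepresentation.lean`) together with Fourier inversion, the solution
with datum `φ` IS `v(T) = M(D)φ` (`multiplierOp_cplx_eq_slice`); derivatives commute with
`M(D)` (`Literature.Analysis.Fourier.fderiv_multiplierOp_apply_of_contDiff`, the symbol being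
bounded by `exists_norm_rauchSymbol_apply_le_single` and measurable), so (5) is the homogeneous
Sobolev bound `Σⱼ‖M(D)∂ⱼφ‖_{L¹} ≤ dc Σⱼ‖∂ⱼφ‖_{L¹}` for real test functions
(`sum_eLpNorm_multiplierOp_partialDeriv_cplx_le`) and, splitting complex test functions into
real and imaginary parts, `HasGradientLpBoundWith 1 (2dc) M`
(`hasGradientLpBoundWith_one_rauchSymbol`); "the hyperbolicity of (1) shows that (5) is valid
with `L¹` replaced by `L²`" is `hasGradientLpBoundWith_two_of_bounded` with the symbol bound;
facts 1 and 2 then give `M ∈ M_p`, `1 < p < 2`, and `p = 2` is Plancherel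
(`eLpNorm_multiplierOp_two_le`). Consequences: the `B₁ = 0` linear step
(`linearL1EstimateForcesCommutation_zero_of`, with Brenner's Cor 3.1
`Rauch1986_LpMultiplier_forces_commutation`) and Rauch's theorem for `B′(ū) = 0` relative to the
five residual facts (`jacobiansCommuteAt_of_hasSmallDataBVEstimate_of_fderiv_B_eq_zero`).

## References

* [Rauch1986] J. Rauch, Comm. Math. Phys. 106 (1986) 481–484, Proof of Theorem p. 483, (5)–(6).
* [Brenner1973] P. Brenner, Ark. Mat. 11 (1973) 75–101, (0.3) p. 75, Lemma 5.1 p. 96.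
-/

noncomputable section

open MeasureTheory Set Filter Matrix FourierTransform
open scoped ENNReal NNReal ContDiff Topology

namespace Literature.Barriers.AtomisticToContinuum

open Literature.Analysis.Fourier QuasilinearSystem

variable {d k : ℕ}

/-! ### Real and imaginary parts of `ℂᵏ`-valued maps -/

/-- Componentwise real part `ℂᵏ → ℝᵏ` as a real continuous linear map. [folklore] -/
def rePi : (Fin k → ℂ) →L[ℝ] (Fin k → ℝ) :=
  ContinuousLinearMap.pi fun i => Complex.reCLM.comp (ContinuousLinearMap.proj i)

/-- Componentwise imaginary part `ℂᵏ → ℝᵏ` as a real continuous linear map. [folklore] -/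
def imPi : (Fin k → ℂ) →L[ℝ] (Fin k → ℝ) :=
  ContinuousLinearMap.pi fun i => Complex.imCLM.comp (ContinuousLinearMap.proj i)

/-- `rePi w i = Re wᵢ`. [folklore] -/
@[simp] theorem rePi_apply (w : Fin k → ℂ) (i : Fin k) : rePi w i = (w i).re := rfl

/-- `imPi w i = Im wᵢ`. [folklore] -/
@[simp] theorem imPi_apply (w : Fin k → ℂ) (i : Fin k) : imPi w i = (w i).im := rfl

/-- `w = (Re w)_ℂ + i (Im w)_ℂ`. [folklore] -/
theorem ofRealPi_rePi_add (w : Fin k → ℂ) : ofRealPi (rePi w) + Complex.I • ofRealPi (imPi w) = w := by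
  ext i
  simp only [Pi.add_apply, Pi.smul_apply, ofRealPi_apply, rePi_apply, imPi_apply, smul_eq_mul]
  rw [mul_comm, Complex.re_add_im]

/-- The sup norm of the complexification: `‖y_ℂ‖ = ‖y‖`. [folklore] -/
theorem norm_ofRealPi (y : Fin k → ℝ) : ‖ofRealPi y‖ = ‖y‖ := by
  refine le_antisymm ?_ ?_
  · refine (pi_norm_le_iff_of_nonneg (norm_nonneg y)).2 fun i => ?_
    rw [ofRealPi_apply, Complex.norm_real]
    exact norm_le_pi_norm y i
  · refine (pi_norm_le_iff_of_nonneg (norm_nonneg _)).2 fun i => ?_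
    rw [← Complex.norm_real]
    exact norm_le_pi_norm (ofRealPi y) i

/-- `‖Re w‖ ≤ ‖w‖` (sup norms). [folklore] -/
theorem norm_rePi_le (w : Fin k → ℂ) : ‖rePi w‖ ≤ ‖w‖ := by
  refine (pi_norm_le_iff_of_nonneg (norm_nonneg w)).2 fun i => ?_
  rw [rePi_apply, Real.norm_eq_abs]
  exact (Complex.abs_re_le_norm _).trans (norm_le_pi_norm w i)

/-- `‖Im w‖ ≤ ‖w‖` (sup norms). [folklore] -/
theorem norm_imPi_le (w : Fin k → ℂ) : ‖imPi w‖ ≤ ‖w‖ := by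
  refine (pi_norm_le_iff_of_nonneg (norm_nonneg w)).2 fun i => ?_
  rw [imPi_apply, Real.norm_eq_abs]
  exact (Complex.abs_im_le_norm _).trans (norm_le_pi_norm w i)

/-! ### Gradient bookkeeping: operator norm versus partial derivatives -/

/-- `‖L‖ ≤ Σⱼ ‖L eⱼ‖` for a linear map on `ℝᵈ` (Euclidean norm). [folklore] -/
theorem opNorm_le_sum_norm_apply_single {F : Type*} [NormedAddCommGroup F] [NormedSpace ℝ F]
    (L : Space d →L[ℝ] F) : ‖L‖ ≤ ∑ j, ‖L (EuclideanSpace.single j 1)‖ := by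
  refine ContinuousLinearMap.opNorm_le_bound _ (Finset.sum_nonneg fun j _ => norm_nonneg _) fun h => ?_
  have hh : h = ∑ j, h j • EuclideanSpace.single j (1 : ℝ) := by
    conv_lhs => rw [← (EuclideanSpace.basisFun (Fin d) ℝ).sum_repr h]
    simp [EuclideanSpace.basisFun_apply]
  conv_lhs => rw [hh]
  rw [map_sum, Finset.sum_mul]
  refine (norm_sum_le _ _).trans (Finset.sum_le_sum fun j _ => ?_)
  rw [map_smul, norm_smul, mul_comm]
  exact mul_le_mul_of_nonneg_left (by simpa using PiLp.norm_apply_le h j) (norm_nonneg _)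

/-- `‖L eⱼ‖ ≤ ‖L‖` (`‖eⱼ‖ = 1`). [folklore] -/
theorem norm_apply_single_le_opNorm {F : Type*} [NormedAddCommGroup F] [NormedSpace ℝ F]
    (L : Space d →L[ℝ] F) (j : Fin d) : ‖L (EuclideanSpace.single j 1)‖ ≤ ‖L‖ := by
  have h := L.le_opNorm (EuclideanSpace.single j (1 : ℝ))
  rwa [PiLp.norm_single, norm_one, mul_one] at h

/-! ### The symbol: measurability and bound (from `NoBVEstimatesMultiDSymbolBound`) -/

section Assembly

variable {A₀ : Matrix (Fin k) (Fin k) ℝ} {A : Fin d → Matrix (Fin k) (Fin k) ℝ}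
  {B₁ : (Fin k → ℝ) →L[ℝ] (Fin k → ℝ)} {T : ℝ}

/-- A nonnegative entry bound `C₀ : ℝ≥0` for Rauch's multiplier of a system in Rauch's class.
[cite: Brenner1973, (0.3) p. 75] -/
theorem exists_nnreal_bound_rauchSymbol (hS : (ofConstant A₀ A B₁).IsRauchClass 0) (T : ℝ) :
    ∃ C₀ : ℝ≥0, ∀ (ξ : Space d) (a b : Fin k), ‖rauchSymbol A₀ A B₁ T ξ a b‖ ≤ C₀ := by
  obtain ⟨C, hC⟩ := exists_norm_rauchSymbol_apply_le_single hS T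
  exact ⟨⟨max C 0, le_max_right _ _⟩, fun ξ a b => (hC ξ a b).trans (le_max_left _ _)⟩

/-! ### `v(T) = M(D)φ` and the `L¹` gradient bound for real test functions -/

/-- **The solution is the multiplier operator applied to the datum**: with finite speed of
propagation, a classical solution `v` on `[0, T]` with datum `φ ∈ C₀^∞` satisfies
`v(T)_ℂ = M(D)φ_ℂ`, `M = rauchSymbol A₀ A B₁ T` (Fourier representation and inversion; the
right side is the genuine inverse Fourier integral since `M` is bounded and `𝓕φ_ℂ` is Schwartz).
[cite: Rauch1986, Proof of Theorem p. 483] -/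
theorem multiplierOp_cplx_eq_slice (hS : (ofConstant A₀ A B₁).IsRauchClass 0) (hdet : A₀.det ≠ 0)
    {cₚ : ℝ} (hcₚ : 0 ≤ cₚ) (hps : (ofConstant A₀ A B₁).HasPropagationSpeed 0 cₚ) (hT : 0 ≤ T)
    {φ : Space d → Fin k → ℝ} (hφ : ContDiff ℝ ∞ φ) (hc : HasCompactSupport φ)
    {v : ℝ → Space d → Fin k → ℝ} (hv : (ofConstant A₀ A B₁).IsClassicalSolution T v)
    (hv0 : ∀ x, v 0 x = φ x) :
    multiplierOp (rauchSymbol A₀ A B₁ T) (cplx φ) = cplx (v T) := by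
  obtain ⟨C₀, hC₀⟩ := exists_nnreal_bound_rauchSymbol hS T
  have hM := measurable_rauchSymbol_apply A₀ A B₁ T
  have hv0' : v 0 = φ := funext hv0
  have h0 : HasCompactSupport (v 0) := by rw [hv0']; exact hc
  have hTmem : T ∈ Icc 0 T := ⟨hT, le_rfl⟩
  -- the Fourier side
  have hF : 𝓕 (cplx (v T)) = fun ξ => rauchSymbol A₀ A B₁ T ξ *ᵥ 𝓕 (cplx φ) ξ := by
    funext ξ
    rw [fourier_cplx_slice_eq_of_hasPropagationSpeed hdet hcₚ hps hv h0 hTmem ξ, hv0']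
  -- integrability of `𝓕(v(T)_ℂ) = M 𝓕φ_ℂ` (bounded times Schwartz)
  set ψ : SchwartzMap (Space d) (Fin k → ℂ) := (hc.cplx).toSchwartzMap (hφ.cplx) with hψ
  have hψc : ⇑ψ = cplx φ := rfl
  have hint : Integrable (𝓕 (cplx (v T))) := by
    rw [hF, ← hψc]
    exact integrable_mulVec_fourier hM C₀.coe_nonneg hC₀ ψ
  -- inversion
  have hvc : Continuous (cplx (v T)) := (contDiff_cplx_slice hv hTmem).continuous
  obtain ⟨R, hR⟩ := exists_eq_zero_of_norm_gt h0
  have hvTc : HasCompactSupport (cplx (v T)) := by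
    refine hasCompactSupport_cplx_slice (ρ := R + cₚ * T) (fun s hs x hx => ?_) hTmem
    refine hps T R v hv hR s hs x (lt_of_le_of_lt ?_ hx)
    have := mul_le_mul_of_nonneg_left hs.2 hcₚ
    linarith
  have hvi : Integrable (cplx (v T)) := hvc.integrable_of_hasCompactSupport hvTc
  have hinv := hvc.fourierInv_fourier_eq hvi hint
  rw [hF] at hinv
  rw [multiplierOp_apply]
  exact hinv

/-- **`M(D)∂ⱼφ_ℂ = (∂ⱼv(T))_ℂ`**: derivatives commute with the multiplier operator (bounded
measurable symbol, `C₀^∞` datum), and `M(D)φ_ℂ = v(T)_ℂ`.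
[cite: Rauch1986, Proof of Theorem p. 483, (5)] -/
theorem multiplierOp_partialDeriv_cplx_eq (hS : (ofConstant A₀ A B₁).IsRauchClass 0)
    (hdet : A₀.det ≠ 0) {cₚ : ℝ} (hcₚ : 0 ≤ cₚ) (hps : (ofConstant A₀ A B₁).HasPropagationSpeed 0 cₚ)
    (hT : 0 ≤ T) {φ : Space d → Fin k → ℝ} (hφ : ContDiff ℝ ∞ φ) (hc : HasCompactSupport φ)
    {v : ℝ → Space d → Fin k → ℝ} (hv : (ofConstant A₀ A B₁).IsClassicalSolution T v)
    (hv0 : ∀ x, v 0 x = φ x) (j : Fin d) (x : Space d) :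
    multiplierOp (rauchSymbol A₀ A B₁ T) (partialDeriv j (cplx φ)) x =
      ofRealPi (fderiv ℝ (v T) x (EuclideanSpace.single j 1)) := by
  obtain ⟨C₀, hC₀⟩ := exists_nnreal_bound_rauchSymbol hS T
  have hM := measurable_rauchSymbol_apply A₀ A B₁ T
  have hTmem : T ∈ Icc 0 T := ⟨hT, le_rfl⟩
  have h1 := fderiv_multiplierOp_apply_of_contDiff hM C₀.coe_nonneg hC₀ hφ.cplx hc.cplx x
    (EuclideanSpace.single j 1)
  have hslice : DifferentiableAt ℝ (v T) x :=
    ((hv.contDiff_slice hTmem).differentiable one_ne_zero).differentiableAt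
  rw [multiplierOp_cplx_eq_slice hS hdet hcₚ hps hT hφ hc hv hv0, fderiv_cplx_apply hslice] at h1
  exact h1.symm

/-- The partial derivatives of a complexified real test function: `∂ⱼ(φ_ℂ) = (∂ⱼφ)_ℂ`.
[folklore] -/
theorem partialDeriv_cplx {φ : Space d → Fin k → ℝ} (hφ : Differentiable ℝ φ) (j : Fin d) :
    partialDeriv j (cplx φ) = fun x => ofRealPi (fderiv ℝ φ x (EuclideanSpace.single j 1)) := by
  funext x
  rw [partialDeriv_apply, fderiv_cplx_apply (hφ x)]

/-- **Rauch's (5) as a homogeneous Sobolev bound for `M(D)`, real test functions**: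
`Σⱼ ‖M(D)∂ⱼφ_ℂ‖_{L¹} ≤ dc Σⱼ ‖∂ⱼφ_ℂ‖_{L¹}`, from `∫‖∇v(T)‖ ≤ c∫‖∇φ‖` for the solution with
datum `φ` (`‖∂ⱼv‖ ≤ ‖∇v‖`, `‖∇φ‖ ≤ Σⱼ‖∂ⱼφ‖`). [cite: Rauch1986, Proof of Theorem p. 483, (5)] -/
theorem sum_eLpNorm_multiplierOp_partialDeriv_cplx_le (hS : (ofConstant A₀ A B₁).IsRauchClass 0)
    (hdet : A₀.det ≠ 0) {cₚ : ℝ} (hcₚ : 0 ≤ cₚ) (hps : (ofConstant A₀ A B₁).HasPropagationSpeed 0 cₚ)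
    (hT : 0 ≤ T) {c : ℝ} (hc0 : 0 ≤ c) {φ : Space d → Fin k → ℝ} (hφ : ContDiff ℝ ∞ φ)
    (hc : HasCompactSupport φ) {v : ℝ → Space d → Fin k → ℝ}
    (hv : (ofConstant A₀ A B₁).IsClassicalSolution T v) (hv0 : ∀ x, v 0 x = φ x)
    (h5 : ∫ x, ‖fderiv ℝ (v T) x‖ ≤ c * ∫ x, ‖fderiv ℝ φ x‖) :
    ∑ j, eLpNorm (multiplierOp (rauchSymbol A₀ A B₁ T) (partialDeriv j (cplx φ))) 1 volume ≤
      ENNReal.ofReal (d * c) * ∑ j, eLpNorm (partialDeriv j (cplx φ)) 1 volume := by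
  have hTmem : T ∈ Icc 0 T := ⟨hT, le_rfl⟩
  -- integrability of the two gradients (continuous, compactly supported)
  have hvT : ContDiff ℝ 1 (v T) := hv.contDiff_slice hTmem
  obtain ⟨R, hR⟩ := exists_eq_zero_of_norm_gt (show HasCompactSupport (v 0) by
    rw [show v 0 = φ from funext hv0]; exact hc)
  have hvTc : HasCompactSupport fun x => v T x - 0 := by
    refine hasCompactSupport_sub_const_of_norm_gt (ρ := R + cₚ * T) fun x hx => ?_
    refine hps T R v hv hR T hTmem x (lt_of_le_of_lt ?_ hx)
    have := mul_le_mul_of_nonneg_left hTmem.2 hcₚ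
    linarith
  have hvTc' : HasCompactSupport (v T) := by simpa using hvTc
  have hgv : Integrable (fderiv ℝ (v T)) := integrable_fderiv_of_hasCompactSupport hvT hvTc'
  have hgφ : Integrable (fderiv ℝ φ) :=
    integrable_fderiv_of_hasCompactSupport (hφ.of_le (mod_cast le_top)) hc
  have hφd : Differentiable ℝ φ := hφ.differentiable (by simp)
  -- left side: `Σⱼ ∫ ‖∂ⱼ v(T)‖ ≤ d ∫ ‖∇v(T)‖`
  have hL : ∀ j, eLpNorm (multiplierOp (rauchSymbol A₀ A B₁ T) (partialDeriv j (cplx φ))) 1 volume ≤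
      ∫⁻ x, ‖fderiv ℝ (v T) x‖ₑ := by
    intro j
    rw [eLpNorm_one_eq_lintegral_enorm]
    refine lintegral_mono fun x => ?_
    rw [multiplierOp_partialDeriv_cplx_eq hS hdet hcₚ hps hT hφ hc hv hv0 j x,
      ← ofReal_norm, ← ofReal_norm, norm_ofRealPi]
    exact ENNReal.ofReal_le_ofReal (norm_apply_single_le_opNorm _ j)
  -- right side: `∫ ‖∇φ‖ ≤ Σⱼ ∫ ‖∂ⱼφ‖`
  have hRside : ENNReal.ofReal (∫ x, ‖fderiv ℝ φ x‖) ≤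
      ∑ j, eLpNorm (partialDeriv j (cplx φ)) 1 volume := by
    have hpi : ∀ j, Integrable fun x => fderiv ℝ φ x (EuclideanSpace.single j 1) := fun j =>
      ((hφ.continuous_fderiv (by simp)).clm_apply continuous_const).integrable_of_hasCompactSupport
        ((hc.fderiv ℝ).mono fun x hx => by
          simp only [Function.mem_support, ne_eq] at hx ⊢
          intro h0
          exact hx (by rw [h0]; rfl))
    calc ENNReal.ofReal (∫ x, ‖fderiv ℝ φ x‖)
        ≤ ENNReal.ofReal (∫ x, ∑ j, ‖fderiv ℝ φ x (EuclideanSpace.single j 1)‖) := by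
          refine ENNReal.ofReal_le_ofReal (integral_mono hgφ.norm
            (integrable_finsetSum _ fun j _ => (hpi j).norm) fun x => ?_)
          exact opNorm_le_sum_norm_apply_single _
      _ = ∑ j, ENNReal.ofReal (∫ x, ‖fderiv ℝ φ x (EuclideanSpace.single j 1)‖) := by
          rw [integral_finsetSum _ fun j _ => (hpi j).norm,
            ENNReal.ofReal_sum_of_nonneg fun j _ => integral_nonneg fun x => norm_nonneg _]
      _ = ∑ j, eLpNorm (partialDeriv j (cplx φ)) 1 volume := by
          refine Finset.sum_congr rfl fun j _ => ?_
          rw [ofReal_integral_norm_eq_lintegral_enorm (hpi j), eLpNorm_one_eq_lintegral_enorm,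
            partialDeriv_cplx hφd j]
          refine lintegral_congr fun x => ?_
          rw [← ofReal_norm, ← ofReal_norm, norm_ofRealPi]
  -- combine with (5)
  calc ∑ j, eLpNorm (multiplierOp (rauchSymbol A₀ A B₁ T) (partialDeriv j (cplx φ))) 1 volume
      ≤ ∑ _j : Fin d, ∫⁻ x, ‖fderiv ℝ (v T) x‖ₑ := Finset.sum_le_sum fun j _ => hL j
    _ = d * ENNReal.ofReal (∫ x, ‖fderiv ℝ (v T) x‖) := by
        rw [Finset.sum_const, Finset.card_univ, Fintype.card_fin, nsmul_eq_mul,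
          ofReal_integral_norm_eq_lintegral_enorm hgv]
    _ ≤ d * ENNReal.ofReal (c * ∫ x, ‖fderiv ℝ φ x‖) := by
        gcongr
    _ = ENNReal.ofReal (d * c) * ENNReal.ofReal (∫ x, ‖fderiv ℝ φ x‖) := by
        rw [ENNReal.ofReal_mul hc0, ENNReal.ofReal_mul (Nat.cast_nonneg d), ENNReal.ofReal_natCast,
          mul_assoc]
    _ ≤ ENNReal.ofReal (d * c) * ∑ j, eLpNorm (partialDeriv j (cplx φ)) 1 volume := by
        gcongr

/-! ### Complex test functions: `HasGradientLpBoundWith 1` -/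

/-- The real-part test function of a complex one is smooth. [folklore] -/
theorem contDiff_rePi_comp {φ : Space d → Fin k → ℂ} (hφ : ContDiff ℝ ∞ φ) :
    ContDiff ℝ ∞ fun x => rePi (φ x) :=
  rePi.contDiff.comp hφ

/-- The imaginary-part test function of a complex one is smooth. [folklore] -/
theorem contDiff_imPi_comp {φ : Space d → Fin k → ℂ} (hφ : ContDiff ℝ ∞ φ) :
    ContDiff ℝ ∞ fun x => imPi (φ x) :=
  imPi.contDiff.comp hφ

/-- Splitting of the partial derivatives into real and imaginary parts:
`∂ⱼφ = (∂ⱼ Re φ)_ℂ + i (∂ⱼ Im φ)_ℂ`. [folklore] -/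
theorem partialDeriv_eq_re_add_im {φ : Space d → Fin k → ℂ} (hφ : Differentiable ℝ φ) (j : Fin d) :
    partialDeriv j φ = fun x => partialDeriv j (cplx fun y => rePi (φ y)) x +
      Complex.I • partialDeriv j (cplx fun y => imPi (φ y)) x := by
  have hre : Differentiable ℝ fun y => rePi (φ y) := rePi.differentiable.comp hφ
  have him : Differentiable ℝ fun y => imPi (φ y) := imPi.differentiable.comp hφ
  funext x
  rw [partialDeriv_cplx hre, partialDeriv_cplx him, partialDeriv_apply]
  simp only
  rw [show (fun y => rePi (φ y)) = rePi ∘ φ from rfl, show (fun y => imPi (φ y)) = imPi ∘ φ from rfl,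
    (rePi.hasFDerivAt.comp x (hφ x).hasFDerivAt).fderiv, (imPi.hasFDerivAt.comp x (hφ x).hasFDerivAt).fderiv,
    ContinuousLinearMap.comp_apply, ContinuousLinearMap.comp_apply, ofRealPi_rePi_add]

/-- `‖∂ⱼ(Re φ)_ℂ(x)‖ ≤ ‖∂ⱼφ(x)‖`. [folklore] -/
theorem norm_partialDeriv_cplx_rePi_le {φ : Space d → Fin k → ℂ} (hφ : Differentiable ℝ φ)
    (j : Fin d) (x : Space d) :
    ‖partialDeriv j (cplx fun y => rePi (φ y)) x‖ ≤ ‖partialDeriv j φ x‖ := by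
  have hre : Differentiable ℝ fun y => rePi (φ y) := rePi.differentiable.comp hφ
  rw [partialDeriv_cplx hre, partialDeriv_apply]
  simp only
  rw [norm_ofRealPi, show (fun y => rePi (φ y)) = rePi ∘ φ from rfl,
    (rePi.hasFDerivAt.comp x (hφ x).hasFDerivAt).fderiv, ContinuousLinearMap.comp_apply]
  exact norm_rePi_le _

/-- `‖∂ⱼ(Im φ)_ℂ(x)‖ ≤ ‖∂ⱼφ(x)‖`. [folklore] -/
theorem norm_partialDeriv_cplx_imPi_le {φ : Space d → Fin k → ℂ} (hφ : Differentiable ℝ φ)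
    (j : Fin d) (x : Space d) :
    ‖partialDeriv j (cplx fun y => imPi (φ y)) x‖ ≤ ‖partialDeriv j φ x‖ := by
  have him : Differentiable ℝ fun y => imPi (φ y) := imPi.differentiable.comp hφ
  rw [partialDeriv_cplx him, partialDeriv_apply]
  simp only
  rw [norm_ofRealPi, show (fun y => imPi (φ y)) = imPi ∘ φ from rfl,
    (imPi.hasFDerivAt.comp x (hφ x).hasFDerivAt).fderiv, ContinuousLinearMap.comp_apply]
  exact norm_imPi_le _

/-- A `C₀^∞` test function's partial derivative is a Schwartz map. [folklore] -/
theorem exists_schwartz_partialDeriv {φ : Space d → Fin k → ℂ} (hφ : ContDiff ℝ ∞ φ)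
    (hc : HasCompactSupport φ) (j : Fin d) :
    ∃ g : SchwartzMap (Space d) (Fin k → ℂ), ⇑g = partialDeriv j φ := by
  have h1 : ContDiff ℝ ∞ (partialDeriv j φ) := by
    have := hφ.fderiv_right (m := ∞) (by norm_cast)
    exact this.clm_apply contDiff_const
  have h2 : HasCompactSupport (partialDeriv j φ) :=
    (hc.fderiv ℝ).mono fun x hx => by
      simp only [Function.mem_support, ne_eq, partialDeriv] at hx ⊢
      intro h0
      exact hx (by rw [h0, _root_.zero_apply])
  exact ⟨h2.toSchwartzMap h1, rfl⟩

/-- **Rauch's (5) gives `HasGradientLpBoundWith 1 (2dc) M` for `M = rauchSymbol A₀ A B₁ T`**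
(complex test functions by splitting into real and imaginary parts).
[cite: Rauch1986, Proof of Theorem p. 483, (5)] -/
theorem hasGradientLpBoundWith_one_rauchSymbol (hS : (ofConstant A₀ A B₁).IsRauchClass 0)
    (hdet : A₀.det ≠ 0) {cₚ : ℝ} (hcₚ : 0 ≤ cₚ) (hps : (ofConstant A₀ A B₁).HasPropagationSpeed 0 cₚ)
    (hT : 0 ≤ T) {c : ℝ} (hc0 : 0 ≤ c)
    (hyp : ∀ φ : Space d → Fin k → ℝ, ContDiff ℝ ∞ φ → HasCompactSupport φ →
      ∃ v : ℝ → Space d → Fin k → ℝ,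
        (ofConstant A₀ A B₁).IsClassicalSolution T v ∧ (∀ x, v 0 x = φ x) ∧
        HasCompactSupport (v T) ∧
        ∫ x, ‖fderiv ℝ (v T) x‖ ≤ c * ∫ x, ‖fderiv ℝ φ x‖) :
    HasGradientLpBoundWith 1 (2 * (d * c)).toNNReal (rauchSymbol A₀ A B₁ T) := by
  obtain ⟨C₀, hC₀⟩ := exists_nnreal_bound_rauchSymbol hS T
  have hM := measurable_rauchSymbol_apply A₀ A B₁ T
  set M := rauchSymbol A₀ A B₁ T with hMdef
  intro φ hφ hc
  have hφd : Differentiable ℝ φ := hφ.differentiable (by simp)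
  -- real and imaginary parts and their solutions
  set φ₁ : Space d → Fin k → ℝ := fun x => rePi (φ x) with hφ₁
  set φ₂ : Space d → Fin k → ℝ := fun x => imPi (φ x) with hφ₂
  have hφ₁s : ContDiff ℝ ∞ φ₁ := contDiff_rePi_comp hφ
  have hφ₂s : ContDiff ℝ ∞ φ₂ := contDiff_imPi_comp hφ
  have hφ₁c : HasCompactSupport φ₁ := hc.comp_left (map_zero rePi)
  have hφ₂c : HasCompactSupport φ₂ := hc.comp_left (map_zero imPi)
  obtain ⟨v₁, hv₁, hv₁0, -, h5₁⟩ := hyp φ₁ hφ₁s hφ₁c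
  obtain ⟨v₂, hv₂, hv₂0, -, h5₂⟩ := hyp φ₂ hφ₂s hφ₂c
  have hB₁ := sum_eLpNorm_multiplierOp_partialDeriv_cplx_le hS hdet hcₚ hps hT hc0 hφ₁s hφ₁c hv₁ hv₁0 h5₁
  have hB₂ := sum_eLpNorm_multiplierOp_partialDeriv_cplx_le hS hdet hcₚ hps hT hc0 hφ₂s hφ₂c hv₂ hv₂0 h5₂
  -- Schwartz representatives
  have hS₀ := exists_schwartz_partialDeriv hφ hc
  have hS₁ := exists_schwartz_partialDeriv hφ₁s.cplx hφ₁c.cplx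
  have hS₂ := exists_schwartz_partialDeriv hφ₂s.cplx hφ₂c.cplx
  refine ⟨fun j => ?_, ?_⟩
  · obtain ⟨g, hg⟩ := hS₀ j
    rw [← hg]
    exact integrable_mulVec_fourier hM C₀.coe_nonneg hC₀ g
  -- the bound
  have hsplit : ∀ j, eLpNorm (multiplierOp M (partialDeriv j φ)) 1 volume ≤
      eLpNorm (multiplierOp M (partialDeriv j (cplx φ₁))) 1 volume +
        eLpNorm (multiplierOp M (partialDeriv j (cplx φ₂))) 1 volume := by
    intro j
    obtain ⟨g₁, hg₁⟩ := hS₁ j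
    obtain ⟨g₂, hg₂⟩ := hS₂ j
    have heq : multiplierOp M (partialDeriv j φ) =
        multiplierOp M (partialDeriv j (cplx φ₁)) + Complex.I • multiplierOp M (partialDeriv j (cplx φ₂)) := by
      have h12 : partialDeriv j φ = ⇑(g₁ + Complex.I • g₂) := by
        funext x
        change _ = g₁ x + Complex.I • g₂ x
        rw [congr_fun hg₁ x, congr_fun hg₂ x]
        exact congr_fun (partialDeriv_eq_re_add_im hφd j) x
      funext x
      rw [h12, multiplierOp_schwartz_add hM C₀.coe_nonneg hC₀, multiplierOp_schwartz_smul, hg₁, hg₂]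
      rfl
    rw [heq]
    have hm₁ : AEStronglyMeasurable (multiplierOp M (partialDeriv j (cplx φ₁))) volume := by
      rw [← hg₁]
      exact (continuous_fourierInv_of_integrable
        (integrable_mulVec_fourier hM C₀.coe_nonneg hC₀ g₁)).aestronglyMeasurable
    have hm₂ : AEStronglyMeasurable (Complex.I • multiplierOp M (partialDeriv j (cplx φ₂))) volume := by
      rw [← hg₂]
      exact ((continuous_fourierInv_of_integrable
        (integrable_mulVec_fourier hM C₀.coe_nonneg hC₀ g₂)).aestronglyMeasurable).const_smul _
    refine (eLpNorm_add_le hm₁ hm₂ le_rfl).trans ?_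
    rw [eLpNorm_const_smul, enorm_eq_nnnorm, Complex.nnnorm_I, ENNReal.coe_one, one_mul]
  calc ∑ j, eLpNorm (multiplierOp M (partialDeriv j φ)) 1 volume
      ≤ ∑ j, (eLpNorm (multiplierOp M (partialDeriv j (cplx φ₁))) 1 volume +
          eLpNorm (multiplierOp M (partialDeriv j (cplx φ₂))) 1 volume) :=
        Finset.sum_le_sum fun j _ => hsplit j
    _ = ∑ j, eLpNorm (multiplierOp M (partialDeriv j (cplx φ₁))) 1 volume +
          ∑ j, eLpNorm (multiplierOp M (partialDeriv j (cplx φ₂))) 1 volume := Finset.sum_add_distrib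
    _ ≤ ENNReal.ofReal (d * c) * ∑ j, eLpNorm (partialDeriv j (cplx φ₁)) 1 volume +
          ENNReal.ofReal (d * c) * ∑ j, eLpNorm (partialDeriv j (cplx φ₂)) 1 volume := add_le_add hB₁ hB₂
    _ ≤ ENNReal.ofReal (d * c) * ∑ j, eLpNorm (partialDeriv j φ) 1 volume +
          ENNReal.ofReal (d * c) * ∑ j, eLpNorm (partialDeriv j φ) 1 volume := by
        gcongr with j _ j _
        · exact eLpNorm_mono fun x => norm_partialDeriv_cplx_rePi_le hφd j x
        · exact eLpNorm_mono fun x => norm_partialDeriv_cplx_imPi_le hφd j x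
    _ = ((2 * (d * c)).toNNReal : ℝ≥0∞) * ∑ j, eLpNorm (partialDeriv j φ) 1 volume := by
        rw [← two_mul, ← mul_assoc, show (2 : ℝ≥0∞) * ENNReal.ofReal (d * c) =
          ENNReal.ofReal (2 * (d * c)) by rw [ENNReal.ofReal_mul zero_le_two, ENNReal.ofReal_ofNat]]
        rfl

/-- `L²` multipliers from the bound: `M ∈ M_2` (Plancherel). [cite: Brenner1973, (0.3) p. 75] -/
theorem isLpMultiplier_two_rauchSymbol (hS : (ofConstant A₀ A B₁).IsRauchClass 0) (T : ℝ) :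
    IsLpMultiplier 2 (rauchSymbol A₀ A B₁ T) := by
  obtain ⟨C₀, hC₀⟩ := exists_nnreal_bound_rauchSymbol hS T
  have hM := measurable_rauchSymbol_apply A₀ A B₁ T
  exact ⟨_, fun f => integrable_mulVec_fourier hM C₀.coe_nonneg hC₀ f,
    fun f => eLpNorm_multiplierOp_two_le hM hC₀ f⟩

/-- **Rauch's reduction relative to its inputs**: the named fact
`Rauch1986_L1GradientEstimate_imp_LpMultiplier` follows from the interpolation of homogeneous
Sobolev bounds (`gradientLpBound_interpolation`), the Riesz-transform step
(`isLpMultiplier_of_gradientLpBound`) and finite speed of propagation for Rauch's class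
(`Rauch1986_finitePropagationSpeed`, used for the constant-coefficient system `A₀∂ₜ + Σ Aⱼ∂ⱼ`
only; its symmetrizable branch is discharged). Everything else — `v(T) = M(D)φ` by the Fourier representation and
inversion, commutation of derivatives with `M(D)`, the `L¹` gradient bound for complex test
functions, the `L²` bound from hyperbolicity, and the case `p = 2` — is proved here.
[cite: Rauch1986, Proof of Theorem p. 483, (5)–(6)] -/
theorem Rauch1986_L1GradientEstimate_imp_LpMultiplier_of (hI : gradientLpBound_interpolation)
    (hR : isLpMultiplier_of_gradientLpBound)
    (hF : Rauch1986_finitePropagationSpeed) :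
    Rauch1986_L1GradientEstimate_imp_LpMultiplier := by
  intro d k A₀ A hS c T hc hT hyp p hp₁ hp₂
  obtain ⟨hdet, -⟩ := exists_continuous_symmetrizer_family hS
  obtain ⟨cₚ, hcₚ, hps⟩ := hF (ofConstant A₀ A 0) 0 hS
  obtain ⟨C₀, hC₀⟩ := exists_nnreal_bound_rauchSymbol hS T
  have hM := measurable_rauchSymbol_apply A₀ A 0 T
  have hbdd : ∃ C : ℝ, ∀ (ξ : Space d) (a b : Fin k), ‖rauchSymbol A₀ A 0 T ξ a b‖ ≤ C := ⟨C₀, hC₀⟩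
  rcases eq_or_lt_of_le hp₂ with rfl | hp₂'
  · exact isLpMultiplier_two_rauchSymbol hS T
  have h1 := hasGradientLpBoundWith_one_rauchSymbol hS hdet hcₚ hps hT.le hc.le hyp
  have h2 := hasGradientLpBoundWith_two_of_bounded hM hC₀
  obtain ⟨cp, hcp⟩ := hI (rauchSymbol A₀ A 0 T) hM hbdd h1 h2 p hp₁ hp₂'
  exact hR (rauchSymbol A₀ A 0 T) hM hbdd p cp hp₁ (hp₂'.trans ENNReal.ofNat_lt_top) hcp

/-- Hence Rauch's linear step WITHOUT zeroth-order term ("(5) ⟹ (3)" for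
`A₀∂ₜv + Σ Aⱼ∂ⱼv = 0`) rests on the same three inputs and Brenner's Corollary 3.1
(`Rauch1986_LpMultiplier_forces_commutation`), via
`Rauch1986_linearL1EstimateForcesCommutation_zero_of_linearFacts`.
[cite: Rauch1986, Proof of Theorem p. 483; Brenner1973, Cor 3.1 p. 84] -/
theorem linearL1EstimateForcesCommutation_zero_of (hI : gradientLpBound_interpolation)
    (hR : isLpMultiplier_of_gradientLpBound) (hF : Rauch1986_finitePropagationSpeed)
    (hB : Rauch1986_LpMultiplier_forces_commutation) ⦃d k : ℕ⦄
    (A₀ : Matrix (Fin k) (Fin k) ℝ) (A : Fin d → Matrix (Fin k) (Fin k) ℝ)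
    (hS : (ofConstant A₀ A 0).IsRauchClass 0) (c T : ℝ) (hc : 0 < c) (hT : 0 < T)
    (hyp : ∀ φ : Space d → Fin k → ℝ, ContDiff ℝ ∞ φ → HasCompactSupport φ →
      ∃ v : ℝ → Space d → Fin k → ℝ,
        (ofConstant A₀ A 0).IsClassicalSolution T v ∧ (∀ x, v 0 x = φ x) ∧
        HasCompactSupport (v T) ∧
        ∫ x, ‖fderiv ℝ (v T) x‖ ≤ c * ∫ x, ‖fderiv ℝ φ x‖)
    (j l : Fin d) : Commute (A₀⁻¹ * A j) (A₀⁻¹ * A l) :=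
  Rauch1986_linearL1EstimateForcesCommutation_zero_of_linearFacts
    (Rauch1986_L1GradientEstimate_imp_LpMultiplier_of hI hR hF) hB A₀ A hS c T hc hT hyp j l

/-- **Rauch's theorem for systems whose zeroth-order term is stationary at `ū`
(`B′(ū) = 0`: every system of conservation laws without source term, in particular the
compressible Euler equations of the barrier's `blocks`) relative to the five residual named facts
of its cone** — the `L²` small-amplitude expansion (`Rauch1986_smallAmplitudeExpansionL2`),
finite speed of propagation for Rauch's class (`Rauch1986_finitePropagationSpeed`, open for
strictly hyperbolic systems with `d ≥ 2`, `k ≥ 3` only), the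
interpolation of homogeneous Sobolev bounds (`gradientLpBound_interpolation`), Rauch's (6)
(`isLpMultiplier_of_gradientLpBound`) and Brenner's Corollary 3.1
(`Rauch1986_LpMultiplier_forces_commutation`): the small-data `BV` estimate (2) at `ū` forces the
commutation relations (3). The proof is that of `NoBVEstimatesMultiDBarrier_of_facts` with the
linear step taken from `linearL1EstimateForcesCommutation_zero_of` (the linearisation at `ū` has
no zeroth-order term). [cite: Rauch1986, Theorem p. 482 and Proof of Theorem pp. 482–483] -/
theorem jacobiansCommuteAt_of_hasSmallDataBVEstimate_of_fderiv_B_eq_zero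
    (hE : Rauch1986_smallAmplitudeExpansionL2) (hF : Rauch1986_finitePropagationSpeed)
    (hI : gradientLpBound_interpolation) (hR : isLpMultiplier_of_gradientLpBound)
    (hB : Rauch1986_LpMultiplier_forces_commutation)
    {S : QuasilinearSystem d k} {ubar : Fin k → ℝ} {s : ℕ} (hS : S.IsRauchClass ubar)
    (hB0 : fderiv ℝ S.B ubar = 0) (hBV : S.HasSmallDataBVEstimate ubar s) :
    S.JacobiansCommuteAt ubar := by
  have h₁ : Rauch1986_smallAmplitudeExpansion := Rauch1986_smallAmplitudeExpansion_of_facts hE hF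
  have hlin : S.linearization ubar = ofConstant (S.A0 ubar) (fun j => S.A j ubar) 0 := by
    rw [linearization, hB0]
  have hS0 : (ofConstant (S.A0 ubar) (fun j => S.A j ubar) 0).IsRauchClass 0 := by
    rw [← hlin]; exact hS.linearization
  obtain ⟨c, T, η, hT, hη, hest⟩ := hBV
  intro j l
  refine linearL1EstimateForcesCommutation_zero_of hI hR hF hB (S.A0 ubar) (fun j => S.A j ubar)
    hS0 (max c 1) T (lt_max_of_lt_right one_pos) hT ?_ j l
  intro φ hφ hφc
  obtain ⟨v, hv, hv0, hvT, u, C, hev⟩ := h₁ S ubar hS hT φ hφ hφc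
  rw [hlin] at hv
  refine ⟨v, hv, hv0, hvT, ?_⟩
  -- `‖εφ‖²_{Hˢ} = ε²‖φ‖²_{Hˢ} < η²` for small `ε`
  have hsmall : ∀ᶠ ε in 𝓝[>] (0 : ℝ), hsNormSq s (ε • φ) < η ^ 2 := by
    have ht : Tendsto (fun ε : ℝ => ε ^ 2 * hsNormSq s φ) (𝓝 0) (𝓝 0) := by
      have := ((continuous_pow 2).mul continuous_const).tendsto (0 : ℝ)
        (f := fun ε : ℝ => ε ^ 2 * hsNormSq s φ)
      simpa using this
    have h2 : ∀ᶠ ε in 𝓝 (0 : ℝ), ε ^ 2 * hsNormSq s φ < η ^ 2 :=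
      ht.eventually_lt_const (by positivity)
    filter_upwards [h2.filter_mono (nhdsWithin_le_nhds (s := Ioi (0 : ℝ)))] with ε hε
    rwa [hsNormSq_const_smul hφ]
  have hpos : ∀ᶠ ε in 𝓝[>] (0 : ℝ), 0 < ε := eventually_mem_nhdsWithin
  have hP : ∀ {ε : ℝ}, 0 < ε → ∫ x, ‖fderiv ℝ (ε • φ) x‖ = ε * ∫ x, ‖fderiv ℝ φ x‖ := by
    intro ε hε
    rw [← integral_const_mul]
    refine integral_congr_ae (Eventually.of_forall fun x => ?_)
    have hdx : DifferentiableAt ℝ φ x := (hφ.differentiable (by simp)).differentiableAt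
    simp only
    rw [fderiv_const_smul hdx ε, norm_smul, Real.norm_eq_abs, abs_of_pos hε]
  have hiv : Integrable (fderiv ℝ (v T)) :=
    integrable_fderiv_of_hasCompactSupport (hv.contDiff_slice ⟨hT.le, le_rfl⟩) hvT
  refine integral_norm_le_of_expansion (g := fun ε => fderiv ℝ (u ε T)) (C := C) hiv ?_
  filter_upwards [hev, hsmall, hpos] with ε ⟨hsol, hdata, hsupp, hrem⟩ hεs hε
  refine ⟨?_, ?_, hrem⟩
  · rw [fderiv_eq_fderiv_sub_const (u ε T) ubar]
    exact integrable_fderiv_of_hasCompactSupport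
      ((hsol.contDiff_slice ⟨hT.le, le_rfl⟩).sub contDiff_const) hsupp
  · have hBVε := hest (ε • φ) (hφ.const_smul ε)
      (hφc.mono (Function.support_const_smul_subset ε φ)) hεs (u ε) hsol
      (fun x => by rw [hdata x, Pi.smul_apply])
    rw [hP hε] at hBVε
    exact hBVε.trans (mul_le_mul_of_nonneg_right (le_max_left c 1)
      (mul_nonneg hε.le (integral_nonneg fun _ => norm_nonneg _)))

/-- **Status of the barrier after this file**: Rauch's theorem `NoBVEstimatesMultiDBarrier` (with
zeroth-order term, `B(ū) = 0`, `B′(ū)` arbitrary) follows from the `L²` small-amplitude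
expansion, finite speed of propagation for Rauch's class and the linear step
`Rauch1986_linearL1EstimateForcesCommutation` (whose case `B₁ = 0` is
`linearL1EstimateForcesCommutation_zero_of` above, and whose case `B₁ ≠ 0` rests on the printed
assertion of [Rauch1986, p. 483], `NoBVEstimatesMultiD.lean` `scope_caveats` (e)).
[cite: Rauch1986, Theorem p. 482 and Proof of Theorem pp. 482–483] -/
theorem NoBVEstimatesMultiDBarrier_of_residualFacts (hE : Rauch1986_smallAmplitudeExpansionL2)
    (hF : Rauch1986_finitePropagationSpeed) (h₂ : Rauch1986_linearL1EstimateForcesCommutation) :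
    NoBVEstimatesMultiDBarrier :=
  NoBVEstimatesMultiDBarrier_of_facts (Rauch1986_smallAmplitudeExpansion_of_facts hE hF) h₂

end Assembly

end Literature.Barriers.AtomisticToContinuum

end
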